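/-
Copyright: statement-level skeleton of a published paper (lit-balaban cell, Phase-2 proof seat p25, gen 18). No proof
claims beyond what the kernel checks below.
-/
import Literature.MathematicalPhysics.QuantumFieldTheory.BalabanImbrieJaffe1984to88.BIJ88WalkRunEnv311
import Literature.Probability.LatticeModels.PolymerGasGeometric

/-!
# `BalabanImbrieJaffe1984to88.BIJ88WalkGeometry311` — T. Bałaban, J. Imbrie, A. Jaffe, *Effective action and cluster
properties of the abelian Higgs model*, Commun. Math. Phys. **114** (1988) 257–315 [BalabanImbrieJaffe1988], §5.14
p. 311 [PDF 55], verbatim: *"After each integration by parts, we replace the covariance by C^{(k)}_{loc} or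
C^{(k)}_{loc}(u_{k+1}) and give a random walk expansion for the difference. For each term, let X be the union of the
cubes covering the X_{σ_i} and the regions from the random walk expansion. A connected component of X …"*, with p. 310
*"we define C^{(k)}_{Λ,loc} by cutting off the kernel when the arguments are separated by O(r(e_k))"* — **THE CUBE SET
`X` OF A COMPONENT AND ITS CONNECTEDNESS** for the run with the covariance split (`BIJ88WalkRun311.run`, p25 gen 18).
`X` of a component = the cubes covering its observables ∪ the localizations of the vertices it differentiated down ∪
the regions of the covariance pieces its contractions used (`cubes`).  THE POINT OF THE SPLIT: when every piece links
the cubes of the two legs it contracts through its region (a local piece of range `r`: adjacent cubes, empty region; a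
random-walk piece: a walk region joining them) — hypotheses `hlink`/`hhalf` on the DATA `Cov`, `reg`, `lc` — then along
every outcome of nonzero weight and nonzero `χ′`-directions the cube set of every component stays `R`-CONNECTED and
contains the cubes of all its pending legs (`run_conn`): print's components of `X` are geometric objects, polymers of
the (5.14.3) gas.  Gen 17's `BIJ88ComponentCubes311.cubes` (legs only, one covariance of unbounded range) had diameter
decay but no connectedness; this is the first file of the lane where `X` is connected.

statement-level skeleton of published theorems with citation tags; proofs where landed; nothing here is a claim
about the Yang–Mills mass gap

PDF held: `paper:balaban1988-cmp114-bij-abelian-higgs-effective-action` (journal page = PDF page + 256); p. 310–312 =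
PDF 54–56 (`p0054.txt` L35–38, `p0055.txt` L23–38 re-read this session, 2026-08-22).

CITATION HEADER (lean-in-tree rule).  lit-balaban cell (HOME `run/shared/lean/pub/lit-balaban/`), Phase 2, seat p25
gen 18; row **C2.Claim@312** of `HOME/lit-balaban-r16/ROWS-C2-part2.md` (owner r16, referee ref-5; head
`BIJ88Sect5StatementsPart4.Ineq312` untouched).  USED BY NAME, nothing restated: `BIJ88WalkRun311.{WGrp, WOut, run,
pristine, WGrp.absorb}`, `BIJ88WalkRunEnv311.run_ind'` (this seat and generation),
`Literature.Probability.LatticeModels.IsRConnected` (the tree's notion of an `R`-connected cell set, the one the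
polymer-gas side `BIJ88Ineq312Instance.norm_Gk_le_printed` quantifies over).

## What is proved (0 `sorry`, standard axioms, no new `Prop` facts; definitions with bodies: `cubes`, `Nondeg`,
`Geo`)

* §1 `mem_msup`, **`cubes`** (`X` of a component) with `mem_cubes`, the event lemmas `cubes_rec` (recording a piece:
  `∪ reg p`), `cubes_lab` (an observable joins: `∪ oc j`), `cubes_vx` (a vertex: `∪ vc m`), `cubes_absorb`
  (`X(g) ∪ X(h) ∪ reg p`), `cubes_pristine` (`= oc j`); the invariant **`Geo`** (`X` is `R`-connected and contains
  the cube of every pending leg), `geo_pristine`.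
* §2 (private) `isRConnected_union_of_mem` (two `R`-connected sets sharing a cube), `getD_mem_or`, `Nondeg` (nonzero
  weight, nonzero `χ′`-directions), **`run_conn`**: from a `Geo` state with `Geo` complete components set aside, every
  nondegenerate outcome has a `Geo` component and `Geo` set-aside components — under `hlink` (a piece with a nonzero
  bracket between two legs has a region which, together with the two legs' cubes, is `R`-connected) and `hhalf` (a
  piece moving a leg at all has a region `R`-connected together with that leg's cube; used for the source and `χ′`),
  observables' legs inside their connected covering cubes, vertices' legs inside their connected localizations.
HONEST SCOPE: (a) contraction-graph components (print's components are the geometric components of `X`; ours are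
`R`-connected, print's are unions of ours at mutual distance ≤ the adjacency); (b) `oc`, `vc`, `reg`, `lc`, `R` and the
two linking hypotheses are DATA/HYPOTHESES shaped after p. 310–311 — print's `C_loc` of range `O(r(e_k))` and the
random-walk expansion of `C − C_loc` (refs. 3–5 of the paper) are not constructed; (c) the cubes hit by `χ′` and the
support of the source are not added to `X` (print's sentence names the observables' cubes and the walk regions only);
(d) connectedness only — no tree/volume decay, no Kotecký–Preiss currency, no estimate; zero-weight outcomes are not
claimed connected.  NOT summit progress; NOT continuum; NOT Clay.  Imports `BIJ88WalkRunEnv311`,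
`Literature.Probability.LatticeModels.PolymerGasGeometric`; modifies nothing.
-/

noncomputable section

namespace Literature.MathematicalPhysics.QuantumFieldTheory.BalabanImbrieJaffe1984to88.BIJ88WalkGeometry311

open Classical Matrix Finset
open scoped BigOperators
open Literature.Probability.LatticeModels (IsRConnected)
open BIJ88WalkRun311 BIJ88WalkRunEnv311

variable {S : Type} [Fintype S] {ι : Type} [Fintype ι] {κ : Type} [DecidableEq κ] {P : Type} [Fintype P]
  {β : Type} [DecidableEq β]

/-! ## §1  The cube set `X` of a component -/

omit [DecidableEq κ] in
/-- Membership in a union over a multiset (bookkeeping). [folklore] -/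
private theorem mem_msup {α : Type} (m : Multiset α) (F : α → Finset β) (x : β) :
    x ∈ (m.map F).sup ↔ ∃ a ∈ m, x ∈ F a := by
  induction m using Multiset.induction_on with
  | empty => simp
  | cons a m ih =>
    simp only [Multiset.map_cons, Multiset.sup_cons, Finset.sup_eq_union, Finset.mem_union, ih, Multiset.mem_cons]
    constructor
    · rintro (h | ⟨b, hb, h⟩)
      · exact ⟨a, Or.inl rfl, h⟩
      · exact ⟨b, Or.inr hb, h⟩
    · rintro ⟨b, rfl | hb, h⟩
      · exact Or.inl h
      · exact Or.inr ⟨b, hb, h⟩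

/-- **`X` of a component** (p. 311 *"let X be the union of the cubes covering the X_{σ_i} and the regions from the
random walk expansion"*, with the localizations of the vertices differentiated down): the cubes `oc j` covering the
observables merged into the component, the cubes `vc m` of its vertices, the regions `reg p` of the covariance pieces
its contractions used. [cite: BalabanImbrieJaffe1988, §5.14 p.311] -/
def cubes (oc : κ → Finset β) (vc : ι → Finset β) (reg : P → Finset β) (g : WGrp S κ ι P) : Finset β :=
  g.lab.biUnion oc ∪ (g.vxs.map vc).sup ∪ (g.pcs.map reg).sup

section Cubes

variable (oc : κ → Finset β) (vc : ι → Finset β) (reg : P → Finset β)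

omit [Fintype S] [Fintype ι] [DecidableEq κ] [Fintype P] in
/-- Membership in `X` of a component. [cite: BalabanImbrieJaffe1988, §5.14 p.311] -/
theorem mem_cubes (g : WGrp S κ ι P) (x : β) :
    x ∈ cubes oc vc reg g ↔ (∃ j ∈ g.lab, x ∈ oc j) ∨ (∃ m ∈ g.vxs, x ∈ vc m) ∨ ∃ p ∈ g.pcs, x ∈ reg p := by
  simp only [cubes, Finset.mem_union, Finset.mem_biUnion, mem_msup, or_assoc]

omit [Fintype S] [Fintype ι] [DecidableEq κ] [Fintype P] in
/-- Recording a piece adds its region to `X` (events (1), (4), (5)). [cite: BalabanImbrieJaffe1988, §5.14 p.311] -/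
theorem cubes_rec (g : WGrp S κ ι P) (L : List (S → ℝ)) (n nw : ℕ) (p : P) :
    cubes oc vc reg (⟨L, n, g.vxs, g.lab, p ::ₘ g.pcs, nw⟩ : WGrp S κ ι P) = cubes oc vc reg g ∪ reg p := by
  ext x
  simp only [mem_cubes, Multiset.mem_cons, Finset.mem_union]
  constructor
  · rintro (h | h | ⟨q, rfl | hq, hx⟩)
    · exact Or.inl (Or.inl h)
    · exact Or.inl (Or.inr (Or.inl h))
    · exact Or.inr hx
    · exact Or.inl (Or.inr (Or.inr ⟨q, hq, hx⟩))
  · rintro ((h | h | ⟨q, hq, hx⟩) | hx)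
    · exact Or.inl h
    · exact Or.inr (Or.inl h)
    · exact Or.inr (Or.inr ⟨q, Or.inr hq, hx⟩)
    · exact Or.inr (Or.inr ⟨p, Or.inl rfl, hx⟩)

omit [Fintype S] [Fintype ι] [Fintype P] in
/-- An observable joining adds its cubes and the piece's region to `X` (event (2)). [cite: BalabanImbrieJaffe1988, §5.14 p.311] -/
theorem cubes_lab (g : WGrp S κ ι P) (L : List (S → ℝ)) (n nw : ℕ) (j : κ) (p : P) :
    cubes oc vc reg (⟨L, n, g.vxs, g.lab ∪ {j}, p ::ₘ g.pcs, nw⟩ : WGrp S κ ι P)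
      = cubes oc vc reg g ∪ oc j ∪ reg p := by
  ext x
  simp only [mem_cubes, Multiset.mem_cons, Finset.mem_union, Finset.mem_singleton]
  constructor
  · rintro (⟨k, hk | hk, hx⟩ | h | ⟨q, rfl | hq, hx⟩)
    · exact Or.inl (Or.inl (Or.inl ⟨k, hk, hx⟩))
    · exact Or.inl (Or.inr (hk ▸ hx))
    · exact Or.inl (Or.inl (Or.inr (Or.inl h)))
    · exact Or.inr hx
    · exact Or.inl (Or.inl (Or.inr (Or.inr ⟨q, hq, hx⟩)))
  · rintro (((⟨k, hk, hx⟩ | h | ⟨q, hq, hx⟩) | hx) | hx)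
    · exact Or.inl ⟨k, Or.inl hk, hx⟩
    · exact Or.inr (Or.inl h)
    · exact Or.inr (Or.inr ⟨q, Or.inr hq, hx⟩)
    · exact Or.inl ⟨j, Or.inr rfl, hx⟩
    · exact Or.inr (Or.inr ⟨p, Or.inl rfl, hx⟩)

omit [Fintype S] [Fintype ι] [DecidableEq κ] [Fintype P] in
/-- A vertex differentiated down adds its localization and the piece's region to `X` (event (6)).
[cite: BalabanImbrieJaffe1988, §5.14 p.311] -/
theorem cubes_vx (g : WGrp S κ ι P) (L : List (S → ℝ)) (n nw : ℕ) (m : ι) (p : P) :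
    cubes oc vc reg (⟨L, n, m ::ₘ g.vxs, g.lab, p ::ₘ g.pcs, nw⟩ : WGrp S κ ι P)
      = cubes oc vc reg g ∪ vc m ∪ reg p := by
  ext x
  simp only [mem_cubes, Multiset.mem_cons, Finset.mem_union]
  constructor
  · rintro (h | ⟨k, rfl | hk, hx⟩ | ⟨q, rfl | hq, hx⟩)
    · exact Or.inl (Or.inl (Or.inl h))
    · exact Or.inl (Or.inr hx)
    · exact Or.inl (Or.inl (Or.inr (Or.inl ⟨k, hk, hx⟩)))
    · exact Or.inr hx
    · exact Or.inl (Or.inl (Or.inr (Or.inr ⟨q, hq, hx⟩)))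
  · rintro (((h | ⟨k, hk, hx⟩ | ⟨q, hq, hx⟩) | hx) | hx)
    · exact Or.inl h
    · exact Or.inr (Or.inl ⟨k, Or.inr hk, hx⟩)
    · exact Or.inr (Or.inr ⟨q, Or.inr hq, hx⟩)
    · exact Or.inr (Or.inl ⟨m, Or.inl rfl, hx⟩)
    · exact Or.inr (Or.inr ⟨p, Or.inl rfl, hx⟩)

omit [Fintype S] [Fintype ι] [Fintype P] in
/-- Absorbing a complete component unites the two cube sets and adds the piece's region (event (3)).
[cite: BalabanImbrieJaffe1988, §5.14 p.311] -/
theorem cubes_absorb (trig : P → Bool) (L : List (S → ℝ)) (g h : WGrp S κ ι P) (i : ℕ) (p : P) :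
    cubes oc vc reg (WGrp.absorb trig L g h i p) = cubes oc vc reg g ∪ cubes oc vc reg h ∪ reg p := by
  ext x
  simp only [WGrp.absorb, mem_cubes, Multiset.mem_cons, Multiset.mem_add, Finset.mem_union]
  constructor
  · rintro (⟨k, hk | hk, hx⟩ | ⟨m, hm | hm, hx⟩ | ⟨q, rfl | hq | hq, hx⟩)
    · exact Or.inl (Or.inl (Or.inl ⟨k, hk, hx⟩))
    · exact Or.inl (Or.inr (Or.inl ⟨k, hk, hx⟩))
    · exact Or.inl (Or.inl (Or.inr (Or.inl ⟨m, hm, hx⟩)))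
    · exact Or.inl (Or.inr (Or.inr (Or.inl ⟨m, hm, hx⟩)))
    · exact Or.inr hx
    · exact Or.inl (Or.inl (Or.inr (Or.inr ⟨q, hq, hx⟩)))
    · exact Or.inl (Or.inr (Or.inr (Or.inr ⟨q, hq, hx⟩)))
  · rintro (((⟨k, hk, hx⟩ | ⟨m, hm, hx⟩ | ⟨q, hq, hx⟩) | (⟨k, hk, hx⟩ | ⟨m, hm, hx⟩ | ⟨q, hq, hx⟩)) | hx)
    · exact Or.inl ⟨k, Or.inl hk, hx⟩
    · exact Or.inr (Or.inl ⟨m, Or.inl hm, hx⟩)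
    · exact Or.inr (Or.inr ⟨q, Or.inr (Or.inl hq), hx⟩)
    · exact Or.inl ⟨k, Or.inr hk, hx⟩
    · exact Or.inr (Or.inl ⟨m, Or.inr hm, hx⟩)
    · exact Or.inr (Or.inr ⟨q, Or.inr (Or.inr hq), hx⟩)
    · exact Or.inr (Or.inr ⟨p, Or.inl rfl, hx⟩)

omit [Fintype S] [Fintype ι] [DecidableEq κ] [Fintype P] in
/-- `X` of a pristine observable is the set of cubes covering it. [cite: BalabanImbrieJaffe1988, §5.14 p.311] -/
theorem cubes_pristine (obs : κ → List (S → ℝ)) (j : κ) :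
    cubes oc vc reg (pristine (ι := ι) (P := P) obs j) = oc j := by
  ext x
  simp only [mem_cubes, pristine, Finset.mem_singleton, Multiset.notMem_zero, false_and, exists_false, or_false,
    exists_eq_left]

omit [Fintype S] [Fintype ι] [DecidableEq κ] [Fintype P] in
/-- `X` does not depend on the pending legs, the `χ′`-count or the random-walk count (bookkeeping).
[cite: BalabanImbrieJaffe1988, §5.14 p.311] -/
theorem cubes_eq_of_records {g g' : WGrp S κ ι P} (hl : g'.lab = g.lab) (hv : g'.vxs = g.vxs) (hp : g'.pcs = g.pcs) :
    cubes oc vc reg g' = cubes oc vc reg g := by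
  simp only [cubes, hl, hv, hp]

/-- **The geometric invariant of a component**: its cube set `X` is `R`-connected and contains the cube of every
pending leg. [cite: BalabanImbrieJaffe1988, §5.14 p.311] -/
def Geo (R : β → β → Prop) (lc : (S → ℝ) → β) (g : WGrp S κ ι P) : Prop :=
  IsRConnected R (cubes oc vc reg g) ∧ ∀ w ∈ g.pend, lc w ∈ cubes oc vc reg g

omit [Fintype S] [Fintype ι] [DecidableEq κ] [Fintype P] in
/-- A pristine observable whose legs lie in its connected covering cubes satisfies the invariant.
[cite: BalabanImbrieJaffe1988, §5.14 p.311] -/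
theorem geo_pristine {R : β → β → Prop} {lc : (S → ℝ) → β} (obs : κ → List (S → ℝ)) (j : κ)
    (hocc : IsRConnected R (oc j)) (hobs : ∀ w ∈ obs j, lc w ∈ oc j) :
    Geo oc vc reg R lc (pristine (ι := ι) (P := P) obs j) := by
  refine ⟨?_, fun w hw => ?_⟩
  · rw [cubes_pristine]; exact hocc
  · rw [cubes_pristine]; exact hobs w hw

end Cubes

/-! ## §2  Connectedness along a run -/

omit [Fintype S] [Fintype ι] [DecidableEq κ] [Fintype P] [DecidableEq β] in
/-- Paths inside a set are paths inside any superset (bookkeeping). [folklore] -/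
private theorem rtg_mono {R : β → β → Prop} {X Y : Finset β} (hXY : X ⊆ Y) {v w : β}
    (h : Relation.ReflTransGen (fun x y => R x y ∧ x ∈ X ∧ y ∈ X) v w) :
    Relation.ReflTransGen (fun x y => R x y ∧ x ∈ Y ∧ y ∈ Y) v w := by
  induction h with
  | refl => exact Relation.ReflTransGen.refl
  | tail _ hbc ih => exact ih.tail ⟨hbc.1, hXY hbc.2.1, hXY hbc.2.2⟩

omit [Fintype S] [Fintype ι] [DecidableEq κ] [Fintype P] in
/-- Two `R`-connected cube sets sharing a cube have an `R`-connected union (bookkeeping). [folklore] -/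
private theorem isRConnected_union_of_mem {R : β → β → Prop} {X Y : Finset β} (hX : IsRConnected R X)
    (hY : IsRConnected R Y) {z : β} (hzX : z ∈ X) (hzY : z ∈ Y) : IsRConnected R (X ∪ Y) := by
  refine ⟨⟨z, Finset.mem_union_left _ hzX⟩, fun v hv w hw => ?_⟩
  have hvz : Relation.ReflTransGen (fun x y => R x y ∧ x ∈ X ∪ Y ∧ y ∈ X ∪ Y) v z := by
    rcases Finset.mem_union.1 hv with hv | hv
    · exact rtg_mono Finset.subset_union_left (hX.2 v hv z hzX)
    · exact rtg_mono Finset.subset_union_right (hY.2 v hv z hzY)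
  have hzw : Relation.ReflTransGen (fun x y => R x y ∧ x ∈ X ∪ Y ∧ y ∈ X ∪ Y) z w := by
    rcases Finset.mem_union.1 hw with hw | hw
    · exact rtg_mono Finset.subset_union_left (hX.2 z hzX w hw)
    · exact rtg_mono Finset.subset_union_right (hY.2 z hzY w hw)
  exact hvz.trans hzw

omit [Fintype S] [Fintype ι] [DecidableEq κ] [Fintype P] in
/-- An `R`-connected set absorbs a subset: `X ∪ Y = X` when `Y ⊆ X` (bookkeeping). [folklore] -/
private theorem union_eq_left_of_subset {X Y : Finset β} (h : Y ⊆ X) : X ∪ Y = X :=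
  Finset.union_eq_left.2 h

omit [Fintype S] in
/-- A positional leg is a leg, or the default `0` (bookkeeping). [folklore] -/
private theorem getD_mem_or (L : List (S → ℝ)) (i : ℕ) : L.getD i 0 ∈ L ∨ L.getD i 0 = 0 := by
  by_cases hi : i < L.length
  · rw [List.getD_eq_getElem L 0 hi]; exact Or.inl (List.getElem_mem hi)
  · exact Or.inr (List.getD_eq_default L 0 (not_lt.1 hi))

/-- **A nondegenerate outcome**: nonzero weight and nonzero `χ′`-directions (the outcomes that contribute; a zero
bracket or a zero direction kills the term). [cite: BalabanImbrieJaffe1988, §5.14 p.311] -/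
def Nondeg (o : WOut S κ ι P) : Prop := o.a ≠ 0 ∧ ∀ z ∈ o.D, z ≠ 0

section Run

variable {Cov : P → Matrix S S ℝ} {trig : P → Bool} {f : S → ℝ} {c : ι → ℝ} {legs : ι → List (S → ℝ)}
  {obs : κ → List (S → ℝ)} {M : ℕ} {oc : κ → Finset β} {vc : ι → Finset β} {reg : P → Finset β}
  {R : β → β → Prop} {lc : (S → ℝ) → β}

omit [Fintype ι] [DecidableEq κ] [Fintype P] in
/-- One linking step: `X ∋ lc u` connected, the link set `{lc u, lc w} ∪ reg p` connected, `Y ∋ lc w` connected ⇒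
`X ∪ Y ∪ reg p` connected (bookkeeping for the events (2), (3), (6)). [cite: BalabanImbrieJaffe1988, §5.14 p.311] -/
private theorem link3 {X Y : Finset β} {x y : β} {Rg : Finset β} (hX : IsRConnected R X) (hx : x ∈ X)
    (hT : IsRConnected R (insert x (insert y Rg))) (hY : IsRConnected R Y) (hy : y ∈ Y) :
    IsRConnected R (X ∪ Y ∪ Rg) := by
  have h1 : IsRConnected R (X ∪ insert x (insert y Rg)) :=
    isRConnected_union_of_mem hX hT hx (Finset.mem_insert_self _ _)
  have h2 : IsRConnected R (X ∪ insert x (insert y Rg) ∪ Y) :=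
    isRConnected_union_of_mem h1 hY (Finset.mem_union_right _ (Finset.mem_insert_of_mem (Finset.mem_insert_self _ _))) hy
  have he : X ∪ insert x (insert y Rg) ∪ Y = X ∪ Y ∪ Rg := by
    ext z
    simp only [Finset.mem_union, Finset.mem_insert]
    constructor
    · rintro ((h | rfl | rfl | h) | h)
      · exact Or.inl (Or.inl h)
      · exact Or.inl (Or.inl hx)
      · exact Or.inl (Or.inr hy)
      · exact Or.inr h
      · exact Or.inl (Or.inr h)
    · rintro ((h | h) | h)
      · exact Or.inl (Or.inl h)
      · exact Or.inr h
      · exact Or.inl (Or.inr (Or.inr (Or.inr h)))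
  rwa [he] at h2

omit [Fintype ι] [DecidableEq κ] [Fintype P] in
/-- One linking step inside a component: `X ∋ lc u, lc w` connected and the link set connected ⇒ `X ∪ reg p` connected
(bookkeeping for the event (1)). [cite: BalabanImbrieJaffe1988, §5.14 p.311] -/
private theorem link2 {X : Finset β} {x y : β} {Rg : Finset β} (hX : IsRConnected R X) (hx : x ∈ X) (hy : y ∈ X)
    (hT : IsRConnected R (insert x (insert y Rg))) : IsRConnected R (X ∪ Rg) := by
  have h := link3 hX hx hT hX hy
  rwa [Finset.union_idempotent] at h

omit [Fintype ι] [DecidableEq κ] [Fintype P] in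
/-- One half-link: `X ∋ lc u` connected and `{lc u} ∪ reg p` connected ⇒ `X ∪ reg p` connected (bookkeeping for the
events (4), (5)). [cite: BalabanImbrieJaffe1988, §5.14 p.311] -/
private theorem link1 {X : Finset β} {x : β} {Rg : Finset β} (hX : IsRConnected R X) (hx : x ∈ X)
    (hT : IsRConnected R (insert x Rg)) : IsRConnected R (X ∪ Rg) := by
  have h1 : IsRConnected R (X ∪ insert x Rg) := isRConnected_union_of_mem hX hT hx (Finset.mem_insert_self _ _)
  have he : X ∪ insert x Rg = X ∪ Rg := by
    ext z
    simp only [Finset.mem_union, Finset.mem_insert]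
    constructor
    · rintro (h | rfl | h)
      · exact Or.inl h
      · exact Or.inl hx
      · exact Or.inr h
    · rintro (h | h)
      · exact Or.inl h
      · exact Or.inr (Or.inr h)
  rwa [he] at h1

/-- **`X` STAYS CONNECTED ALONG A RUN** (p. 311: the components of `X` built by local contractions and random-walk
regions).  Hypotheses on the data: `hlink` — a piece with a nonzero bracket between two legs has a region which
together with the two legs' cubes is `R`-connected (a local piece: the two cubes are adjacent; a random-walk piece: the
walk joins them); `hhalf` — a piece moving a leg at all (`Cov p u ≠ 0`) has a region `R`-connected together with that
leg's cube; the legs of every observable lie in its `R`-connected covering cubes, the legs of every vertex in its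
`R`-connected localization.  Conclusion: from a component satisfying `Geo` with `Geo` complete components set aside,
every NONDEGENERATE outcome (nonzero weight, nonzero `χ′`-directions) has a `Geo` component — `X` is `R`-connected and
carries all pending legs — and `Geo` set-aside components. [cite: BalabanImbrieJaffe1988, §5.14 p.311] -/
theorem run_conn
    (hlink : ∀ p u w, (Cov p *ᵥ u) ⬝ᵥ w ≠ 0 → IsRConnected R (insert (lc u) (insert (lc w) (reg p))))
    (hhalf : ∀ p u, Cov p *ᵥ u ≠ 0 → IsRConnected R (insert (lc u) (reg p)))
    (hocc : ∀ j, IsRConnected R (oc j)) (hobs : ∀ j, ∀ w ∈ obs j, lc w ∈ oc j)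
    (hvcc : ∀ m, IsRConnected R (vc m)) (hlegs : ∀ m, ∀ w ∈ legs m, lc w ∈ vc m)
    (g : WGrp S κ ι P) (rest : Finset κ) (done : Multiset (WGrp S κ ι P)) :
    ∀ o ∈ run Cov trig f c legs obs M g rest done,
      Geo oc vc reg R lc g → (∀ h ∈ done, Geo oc vc reg R lc h) → Nondeg o →
        Geo oc vc reg R lc o.g ∧ ∀ h ∈ o.done, Geo oc vc reg R lc h := by
  refine run_ind' (Q := fun g _ done o => Geo oc vc reg R lc g → (∀ h ∈ done, Geo oc vc reg R lc h) → Nondeg o →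
      Geo oc vc reg R lc o.g ∧ ∀ h ∈ o.done, Geo oc vc reg R lc h)
    (fun _ _ _ _ hg hd _ => ⟨hg, hd⟩) ?_ ?_ ?_ ?_ ?_ ?_ g rest done
  · -- (1) a contraction inside the component
    intro g rest done u L p _ hp i o _ IH hg hd hnd
    have hnd' : Nondeg o := ⟨right_ne_zero_of_mul hnd.1, hnd.2⟩
    have hw : (Cov p *ᵥ u) ⬝ᵥ L.getD i 0 ≠ 0 := left_ne_zero_of_mul hnd.1
    refine IH ⟨?_, fun w hw' => ?_⟩ hd hnd'
    · rw [cubes_rec]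
      have hu : lc u ∈ cubes oc vc reg g := hg.2 u (by rw [hp]; exact List.mem_cons_self)
      have hy : lc (L.getD i 0) ∈ cubes oc vc reg g := by
        rcases getD_mem_or L i with h | h
        · exact hg.2 _ (by rw [hp]; exact List.mem_cons_of_mem _ h)
        · exfalso; rw [h, dotProduct_zero] at hw; exact hw rfl
      exact link2 hg.1 hu hy (hlink p u _ hw)
    · rw [cubes_rec]
      exact Finset.mem_union_left _ (hg.2 w (by rw [hp]; exact List.mem_cons_of_mem _ (List.mem_of_mem_eraseIdx hw')))
  · -- (2) a pristine observable joins
    intro g rest done u L p _ hp j _ i o _ IH hg hd hnd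
    have hnd' : Nondeg o := ⟨right_ne_zero_of_mul hnd.1, hnd.2⟩
    have hw : (Cov p *ᵥ u) ⬝ᵥ (obs j).getD i 0 ≠ 0 := left_ne_zero_of_mul hnd.1
    refine IH ⟨?_, fun w hw' => ?_⟩ hd hnd'
    · rw [cubes_lab]
      have hu : lc u ∈ cubes oc vc reg g := hg.2 u (by rw [hp]; exact List.mem_cons_self)
      have hy : lc ((obs j).getD i 0) ∈ oc j := by
        rcases getD_mem_or (obs j) i with h | h
        · exact hobs j _ h
        · exfalso; rw [h, dotProduct_zero] at hw; exact hw rfl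
      exact link3 hg.1 hu (hlink p u _ hw) (hocc j) hy
    · rw [cubes_lab]
      simp only [Finset.mem_union]
      rcases List.mem_append.1 hw' with h | h
      · exact Or.inl (Or.inl (hg.2 w (by rw [hp]; exact List.mem_cons_of_mem _ h)))
      · exact Or.inl (Or.inr (hobs j w (List.mem_of_mem_eraseIdx h)))
  · -- (3) a complete component set aside joins
    intro g rest done u L p _ hp h hh i hi o _ IH hg hd hnd
    have hnd' : Nondeg o := ⟨right_ne_zero_of_mul hnd.1, hnd.2⟩
    have hw : (Cov p *ᵥ u) ⬝ᵥ h.pend.getD i 0 ≠ 0 := left_ne_zero_of_mul hnd.1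
    have hgeo : Geo oc vc reg R lc h := hd h hh
    refine IH ⟨?_, fun w hw' => ?_⟩ (fun h' hh' => hd h' (Multiset.mem_of_le (Multiset.erase_le _ _) hh')) hnd'
    · rw [cubes_absorb]
      have hu : lc u ∈ cubes oc vc reg g := hg.2 u (by rw [hp]; exact List.mem_cons_self)
      have hy : lc (h.pend.getD i 0) ∈ cubes oc vc reg h := by
        rw [List.getD_eq_getElem _ 0 hi]; exact hgeo.2 _ (List.getElem_mem hi)
      exact link3 hg.1 hu (hlink p u _ hw) hgeo.1 hy
    · rw [cubes_absorb]
      simp only [WGrp.absorb, List.mem_append, Finset.mem_union] at hw' ⊢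
      rcases hw' with h' | h'
      · exact Or.inl (Or.inl (hg.2 w (by rw [hp]; exact List.mem_cons_of_mem _ h')))
      · exact Or.inl (Or.inr (hgeo.2 w (List.mem_of_mem_eraseIdx h')))
  · -- (4) the source
    intro g rest done u L p _ hp o _ IH hg hd hnd
    have hnd' : Nondeg o := ⟨right_ne_zero_of_mul hnd.1, hnd.2⟩
    have hw : (Cov p *ᵥ u) ⬝ᵥ f ≠ 0 := left_ne_zero_of_mul hnd.1
    have hCu : Cov p *ᵥ u ≠ 0 := by intro h0; rw [h0, zero_dotProduct] at hw; exact hw rfl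
    refine IH ⟨?_, fun w hw' => ?_⟩ hd hnd'
    · rw [cubes_rec]
      exact link1 hg.1 (hg.2 u (by rw [hp]; exact List.mem_cons_self)) (hhalf p u hCu)
    · rw [cubes_rec]
      exact Finset.mem_union_left _ (hg.2 w (by rw [hp]; exact List.mem_cons_of_mem _ hw'))
  · -- (5) χ′
    intro g rest done u L p _ hp o _ IH hg hd hnd
    have hCu : Cov p *ᵥ u ≠ 0 := hnd.2 _ (by simp only [WOut.push_D]; exact List.mem_cons_self)
    have hnd' : Nondeg o := ⟨hnd.1, fun z hz => hnd.2 z (by simp only [WOut.push_D]; exact List.mem_cons_of_mem _ hz)⟩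
    refine IH ⟨?_, fun w hw' => ?_⟩ hd hnd'
    · rw [cubes_rec]
      exact link1 hg.1 (hg.2 u (by rw [hp]; exact List.mem_cons_self)) (hhalf p u hCu)
    · rw [cubes_rec]
      exact Finset.mem_union_left _ (hg.2 w (by rw [hp]; exact List.mem_cons_of_mem _ hw'))
  · -- (6) a vertex differentiated down
    intro g rest done u L p _ hp m j o _ IH hg hd hnd
    have ha : -(c m * ((Cov p *ᵥ u) ⬝ᵥ (legs m).getD j 0)) * o.a ≠ 0 := hnd.1
    have hnd' : Nondeg o := ⟨right_ne_zero_of_mul ha, hnd.2⟩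
    have hw : (Cov p *ᵥ u) ⬝ᵥ (legs m).getD j 0 ≠ 0 :=
      right_ne_zero_of_mul (neg_ne_zero.1 (left_ne_zero_of_mul ha))
    refine IH ⟨?_, fun w hw' => ?_⟩ hd hnd'
    · rw [cubes_vx]
      have hu : lc u ∈ cubes oc vc reg g := hg.2 u (by rw [hp]; exact List.mem_cons_self)
      have hy : lc ((legs m).getD j 0) ∈ vc m := by
        rcases getD_mem_or (legs m) j with h | h
        · exact hlegs m _ h
        · exfalso; rw [h, dotProduct_zero] at hw; exact hw rfl
      exact link3 hg.1 hu (hlink p u _ hw) (hvcc m) hy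
    · rw [cubes_vx]
      simp only [Finset.mem_union]
      rcases List.mem_append.1 hw' with h | h
      · exact Or.inl (Or.inl (hg.2 w (by rw [hp]; exact List.mem_cons_of_mem _ h)))
      · exact Or.inl (Or.inr (hlegs m w (List.mem_of_mem_eraseIdx h)))

/-- **Corollary — the run of a pristine observable**: every nondegenerate outcome of the run of `F_{k,loc}(X_{σ_j})`
(with `Geo` complete components set aside) has an `R`-connected `X` carrying all its pending legs.
[cite: BalabanImbrieJaffe1988, §5.14 p.311] -/
theorem run_conn_pristine
    (hlink : ∀ p u w, (Cov p *ᵥ u) ⬝ᵥ w ≠ 0 → IsRConnected R (insert (lc u) (insert (lc w) (reg p))))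
    (hhalf : ∀ p u, Cov p *ᵥ u ≠ 0 → IsRConnected R (insert (lc u) (reg p)))
    (hocc : ∀ j, IsRConnected R (oc j)) (hobs : ∀ j, ∀ w ∈ obs j, lc w ∈ oc j)
    (hvcc : ∀ m, IsRConnected R (vc m)) (hlegs : ∀ m, ∀ w ∈ legs m, lc w ∈ vc m)
    (j : κ) (rest : Finset κ) {done : Multiset (WGrp S κ ι P)} (hd : ∀ h ∈ done, Geo oc vc reg R lc h) :
    ∀ o ∈ run Cov trig f c legs obs M (pristine obs j) rest done, Nondeg o →
      Geo oc vc reg R lc o.g ∧ ∀ h ∈ o.done, Geo oc vc reg R lc h :=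
  fun o ho hnd => run_conn hlink hhalf hocc hobs hvcc hlegs _ rest done o ho
    (geo_pristine oc vc reg obs j (hocc j) (hobs j)) hd hnd

end Run

end Literature.MathematicalPhysics.QuantumFieldTheory.BalabanImbrieJaffe1984to88.BIJ88WalkGeometry311

end
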